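import Summits.AtomisticToContinuum.FouriersLaw.Theorems.PhononMeanFreePathCoherentDephasingBulkContact

/-!
# Split of the crux `PhononMeanFreePath.CoherentDephasing` (stmt-AtomisticToContinuum-11810) into BULK + CONTACT children

Strategist's glue for the route-level decomposition (D-0019 glued split, crux-strategist protocol (b)) of the rank-2 crux
`CoherentDephasing` of route `PhononMeanFreePath` into the two children

* `BulkBlockLossBound` — the `N`-UNIFORM RELATIVE block loss (coarse-grained Fermi-golden-rule / Beer–Lambert) bound of the
  Gibbs-averaged linear response field of the momentum kick at site `0`, required only for BULK blocks of `L₀` consecutive sites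
  `x, …, x+L₀-1` with `L ≤ x` and `x + L₀ + K ≤ N` (distance `≥ K+1` from the far bath): `κ Σ_block E_x ≤ Σ_block s_x` with a
  rate `κ > 0`, a block length `L₀ ≥ 1`, a head margin `L`, a boundary-layer depth `K` and a threshold `N₀` chosen per parameter
  point, uniformly in `N ≥ N₀` (`E_x = cohEnergy`, `s_x = siteWork` of `Theorems/PhononMeanFreePathDefs`) — verbatim the lead's
  v6 stub `stub_bulkBlockLossBound` of `Cruxes/CoherentDephasing/Lines/Sketch_BulkContact_v6candidate.lean`;
* `ContactBound` — for all SUFFICIENTLY DEEP contact regions (`∃ K₀, ∀ K ≥ K₀`), eventually in `N`, the far-bath coherent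
  dissipation is at most `(1+C) ×` the positive part of the time-integrated coherent energy flux into the last `K+1` sites:
  `γ ∫₀^∞ m_N² ≤ (1+C) · max(Ĵ_{N-K-1}, 0)` (`m_N = momResp … (Fin.last N) = r_N`, `Ĵ = harmFlux`; `C = 0` is work-passivity of
  the contact region) — the lead's v6 `stub_contactBound` asks this for EVERY `K`; the upward-closed `∃ K₀, ∀ K ≥ K₀` form is
  the weakest one the composition needs (the bulk child's boundary-layer depth is raised to `max K K₀`),

stated here VERBATIM in the unfolded (kernel-level) form in which the gate writes them into the route file (the route file cannot
import the Defs vocabulary, which imports it); the read-backs `bulkBlockLossBound_iff` / `contactBound_iff` to the Defs vocabulary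
are `Iff.rfl`. The implication `BulkBlockLossBound → ContactBound → CoherentDephasing` is the landed two-hypothesis reduction
`BulkContact.coherentDephasing_of_bulkBlockLoss_of_contactBound` (p137053) fed with the common depth `K ⊔ K₀` (fewer bulk blocks to
check) and the merged threshold `N₀ ⊔ N₁`. Pure logic on top of p137053; no new mathematics.
-/

noncomputable section

open MeasureTheory Set Filter Topology

namespace Summit.AtomisticToContinuum.FouriersLaw.Theorems.CoherentDephasing.Split

open Literature.MathematicalPhysics.KineticTheory.HeatConduction (pinnedChain PhaseSpace)
open Summit.AtomisticToContinuum.FouriersLaw.Theses.PhononMeanFreePath (CoherentDephasing)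
open Summit.AtomisticToContinuum.FouriersLaw.Theorems.PhononMeanFreePath

/-- **The crux from its two children** (glue of the split `CoherentDephasing ⇐ BulkBlockLossBound ∧ ContactBound`).
Hypothesis 1 is `BulkBlockLossBound` and hypothesis 2 is `ContactBound`, each written out at kernel level exactly as in the
route file; the conclusion is the route decl `PhononMeanFreePath.CoherentDephasing` by name. Proof: take the bulk data
`(L₀, L, K, N₀, κ)`, the contact threshold `K₀`, the common depth `K' = max K K₀` (every block with `x + L₀ + K' ≤ N` is a bulk
block), the contact data `(N₁, C)` at depth `K'`, and feed `coherentDephasing_of_bulkBlockLoss_of_contactBound` (p137053) with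
threshold `max N₀ N₁`. [folklore] -/
theorem coherentDephasing_of_subs :
    (∀ ω₂ lam β γ : ℝ, 0 < ω₂ → 0 < lam → 0 < β → 0 < γ → ∀ T : ℝ, 0 < T → ∃ L₀ L K N₀ : ℕ, ∃ κ : ℝ, 0 < L₀ ∧ 0 < κ ∧ ∀ N : ℕ, N₀ ≤ N → ∀ (x : ℕ) (hx : x + L₀ + K ≤ N), L ≤ x → κ * ∑ i : Fin L₀, (∫ t in Set.Ioi (0 : ℝ), (((∫ z, z.2 0 * (∫ y, y.2 (⟨x + (i : ℕ), by omega⟩ : Fin (N + 1)) ∂((Literature.MathematicalPhysics.KineticTheory.HeatConduction.pinnedChain ω₂ lam β γ).transitionKernel (N + 1) T T t.toNNReal z)) ∂((Literature.MathematicalPhysics.KineticTheory.HeatConduction.pinnedChain ω₂ lam β γ).gibbsMeasure (N + 1) T)) ^ 2 + ω₂ * (∫ z, z.2 0 * (∫ y, y.1 (⟨x + (i : ℕ), by omega⟩ : Fin (N + 1)) ∂((Literature.MathematicalPhysics.KineticTheory.HeatConduction.pinnedChain ω₂ lam β γ).transitionKernel (N + 1) T T t.toNNReal z)) ∂((Literature.MathematicalPhysics.KineticTheory.HeatConduction.pinnedChain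 ω₂ lam β γ).gibbsMeasure (N + 1) T)) ^ 2) / 2 + (1 / 4) * ∑ b : Fin N, if (b : ℕ) = x + (i : ℕ) ∨ (b : ℕ) + 1 = x + (i : ℕ) then ((∫ z, z.2 0 * (∫ y, y.1 b.succ ∂((Literature.MathematicalPhysics.KineticTheory.HeatConduction.pinnedChain ω₂ lam β γ).transitionKernel (N + 1) T T t.toNNReal z)) ∂((Literature.MathematicalPhysics.KineticTheory.HeatConduction.pinnedChain ω₂ lam β γ).gibbsMeasure (N + 1) T)) - (∫ z, z.2 0 * (∫ y, y.1 b.castSucc ∂((Literature.MathematicalPhysics.KineticTheory.HeatConduction.pinnedChain ω₂ lam β γ).transitionKernel (N + 1) T T t.toNNReal z)) ∂((Literature.MathematicalPhysics.KineticTheory.HeatConduction.pinnedChain ω₂ lam β γ).gibbsMeasure (N + 1) T))) ^ 2 else 0)) ≤ ∑ i : Fin L₀, (lam * (∫ t in Set.Ioi (0 : ℝ), (∫ z, z.2 0 * (∫ y, y.2 (⟨x + (i : ℕ), by omega⟩ : Fin (N + 1)) ∂((Literature.MathematicalPhysics.KineticTheory.HeatConduction.pinnedChain ω₂ lam β γ).transitionKernel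 (N + 1) T T t.toNNReal z)) ∂((Literature.MathematicalPhysics.KineticTheory.HeatConduction.pinnedChain ω₂ lam β γ).gibbsMeasure (N + 1) T)) * (∫ z, z.2 0 * (∫ y, y.1 (⟨x + (i : ℕ), by omega⟩ : Fin (N + 1)) ^ 3 ∂((Literature.MathematicalPhysics.KineticTheory.HeatConduction.pinnedChain ω₂ lam β γ).transitionKernel (N + 1) T T t.toNNReal z)) ∂((Literature.MathematicalPhysics.KineticTheory.HeatConduction.pinnedChain ω₂ lam β γ).gibbsMeasure (N + 1) T))) + β * ∑ b : Fin N, ((if (b : ℕ) + 1 = x + (i : ℕ) then (1 : ℝ) else 0) - (if (b : ℕ) = x + (i : ℕ) then 1 else 0)) * ∫ t in Set.Ioi (0 : ℝ), (∫ z, z.2 0 * (∫ y, y.2 (⟨x + (i : ℕ), by omega⟩ : Fin (N + 1)) ∂((Literature.MathematicalPhysics.KineticTheory.HeatConduction.pinnedChain ω₂ lam β γ).transitionKernel (N + 1) T T t.toNNReal z)) ∂((Literature.MathematicalPhysics.KineticTheory.HeatConduction.pinnedChain ω₂ lam β γ).gibbsMeasure (N + 1) T)) * (∫ z, z.2 0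 * (∫ y, (y.1 (b).succ - y.1 (b).castSucc) ^ 3 ∂((Literature.MathematicalPhysics.KineticTheory.HeatConduction.pinnedChain ω₂ lam β γ).transitionKernel (N + 1) T T t.toNNReal z)) ∂((Literature.MathematicalPhysics.KineticTheory.HeatConduction.pinnedChain ω₂ lam β γ).gibbsMeasure (N + 1) T)))) →
    (∀ ω₂ lam β γ : ℝ, 0 < ω₂ → 0 < lam → 0 < β → 0 < γ → ∀ T : ℝ, 0 < T → ∃ K₀ : ℕ, ∀ K : ℕ, K₀ ≤ K → ∃ N₀ : ℕ, ∃ C : ℝ, 0 ≤ C ∧ ∀ (N : ℕ) (hN : K < N), N₀ ≤ N → γ * ∫ t in Set.Ioi (0 : ℝ), (∫ z, z.2 0 * (∫ y, y.2 (Fin.last N) ∂((Literature.MathematicalPhysics.KineticTheory.HeatConduction.pinnedChain ω₂ lam β γ).transitionKernel (N + 1) T T t.toNNReal z)) ∂((Literature.MathematicalPhysics.KineticTheory.HeatConduction.pinnedChain ω₂ lam β γ).gibbsMeasure (N + 1) T)) ^ 2 ≤ (1 + C) * max (-(1 / 2) * ∫ t in Set.Ioi (0 : ℝ), ((∫ z,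 z.2 0 * (∫ y, y.2 ((⟨N - K - 1, by omega⟩ : Fin N)).castSucc ∂((Literature.MathematicalPhysics.KineticTheory.HeatConduction.pinnedChain ω₂ lam β γ).transitionKernel (N + 1) T T t.toNNReal z)) ∂((Literature.MathematicalPhysics.KineticTheory.HeatConduction.pinnedChain ω₂ lam β γ).gibbsMeasure (N + 1) T)) + (∫ z, z.2 0 * (∫ y, y.2 ((⟨N - K - 1, by omega⟩ : Fin N)).succ ∂((Literature.MathematicalPhysics.KineticTheory.HeatConduction.pinnedChain ω₂ lam β γ).transitionKernel (N + 1) T T t.toNNReal z)) ∂((Literature.MathematicalPhysics.KineticTheory.HeatConduction.pinnedChain ω₂ lam β γ).gibbsMeasure (N + 1) T))) * ((∫ z, z.2 0 * (∫ y, y.1 ((⟨N - K - 1, by omega⟩ : Fin N)).succ ∂((Literature.MathematicalPhysics.KineticTheory.HeatConduction.pinnedChain ω₂ lam β γ).transitionKernel (N + 1) T T t.toNNReal z)) ∂((Literature.MathematicalPhysics.KineticTheory.HeatConduction.pinnedChain ω₂ lam β γ).gibbsMeasure (N + 1) T)) - (∫ z, z.2 0 * (∫ y, y.1 ((⟨N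 - K - 1, by omega⟩ : Fin N)).castSucc ∂((Literature.MathematicalPhysics.KineticTheory.HeatConduction.pinnedChain ω₂ lam β γ).transitionKernel (N + 1) T T t.toNNReal z)) ∂((Literature.MathematicalPhysics.KineticTheory.HeatConduction.pinnedChain ω₂ lam β γ).gibbsMeasure (N + 1) T)))) 0) →
    CoherentDephasing := by
  intro hbulk hcontact
  refine BulkContact.coherentDephasing_of_bulkBlockLoss_of_contactBound ?_
  intro ω₂ lam β γ hω hl hβ hγ T hT
  obtain ⟨L₀, L, K, N₀, κ, hL₀, hκ, hb⟩ := hbulk ω₂ lam β γ hω hl hβ hγ T hT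
  obtain ⟨K₀, hK₀⟩ := hcontact ω₂ lam β γ hω hl hβ hγ T hT
  obtain ⟨N₁, C, hC, hc⟩ := hK₀ (max K K₀) (le_max_right K K₀)
  refine ⟨L₀, L, max K K₀, max N₀ N₁, κ, C, hL₀, hκ, hC, fun N hN x hx hLx => ?_,
    fun N hKN hN => hc N hKN (le_of_max_le_right hN)⟩
  have hKK : K ≤ max K K₀ := le_max_left K K₀
  have hx' : x + L₀ + K ≤ N := by omega
  exact hb N (le_of_max_le_left hN) x hx' hLx

/-- Read-back: hypothesis 1 of `coherentDephasing_of_subs` (the child `BulkBlockLossBound`, unfolded) is by `Iff.rfl` the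
bulk block loss bound over the Defs vocabulary (`cohEnergy`, `siteWork`) — the lead's v6 `stub_bulkBlockLossBound`. [folklore] -/
theorem bulkBlockLossBound_iff :
    (∀ ω₂ lam β γ : ℝ, 0 < ω₂ → 0 < lam → 0 < β → 0 < γ → ∀ T : ℝ, 0 < T → ∃ L₀ L K N₀ : ℕ, ∃ κ : ℝ, 0 < L₀ ∧ 0 < κ ∧ ∀ N : ℕ, N₀ ≤ N → ∀ (x : ℕ) (hx : x + L₀ + K ≤ N), L ≤ x → κ * ∑ i : Fin L₀, (∫ t in Set.Ioi (0 : ℝ), (((∫ z, z.2 0 * (∫ y, y.2 (⟨x + (i : ℕ), by omega⟩ : Fin (N + 1)) ∂((Literature.MathematicalPhysics.KineticTheory.HeatConduction.pinnedChain ω₂ lam β γ).transitionKernel (N + 1) T T t.toNNReal z)) ∂((Literature.MathematicalPhysics.KineticTheory.HeatConduction.pinnedChain ω₂ lam β γ).gibbsMeasure (N + 1) T)) ^ 2 + ω₂ * (∫ z, z.2 0 * (∫ y, y.1 (⟨x + (i : ℕ), by omega⟩ : Fin (N + 1)) ∂((Literature.MathematicalPhysics.KineticTheory.HeatConduction.pinnedChain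 ω₂ lam β γ).transitionKernel (N + 1) T T t.toNNReal z)) ∂((Literature.MathematicalPhysics.KineticTheory.HeatConduction.pinnedChain ω₂ lam β γ).gibbsMeasure (N + 1) T)) ^ 2) / 2 + (1 / 4) * ∑ b : Fin N, if (b : ℕ) = x + (i : ℕ) ∨ (b : ℕ) + 1 = x + (i : ℕ) then ((∫ z, z.2 0 * (∫ y, y.1 b.succ ∂((Literature.MathematicalPhysics.KineticTheory.HeatConduction.pinnedChain ω₂ lam β γ).transitionKernel (N + 1) T T t.toNNReal z)) ∂((Literature.MathematicalPhysics.KineticTheory.HeatConduction.pinnedChain ω₂ lam β γ).gibbsMeasure (N + 1) T)) - (∫ z, z.2 0 * (∫ y, y.1 b.castSucc ∂((Literature.MathematicalPhysics.KineticTheory.HeatConduction.pinnedChain ω₂ lam β γ).transitionKernel (N + 1) T T t.toNNReal z)) ∂((Literature.MathematicalPhysics.KineticTheory.HeatConduction.pinnedChain ω₂ lam β γ).gibbsMeasure (N + 1) T))) ^ 2 else 0)) ≤ ∑ i : Fin L₀, (lam * (∫ t in Set.Ioi (0 : ℝ), (∫ z, z.2 0 * (∫ y, y.2 (⟨x + (i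 : ℕ), by omega⟩ : Fin (N + 1)) ∂((Literature.MathematicalPhysics.KineticTheory.HeatConduction.pinnedChain ω₂ lam β γ).transitionKernel (N + 1) T T t.toNNReal z)) ∂((Literature.MathematicalPhysics.KineticTheory.HeatConduction.pinnedChain ω₂ lam β γ).gibbsMeasure (N + 1) T)) * (∫ z, z.2 0 * (∫ y, y.1 (⟨x + (i : ℕ), by omega⟩ : Fin (N + 1)) ^ 3 ∂((Literature.MathematicalPhysics.KineticTheory.HeatConduction.pinnedChain ω₂ lam β γ).transitionKernel (N + 1) T T t.toNNReal z)) ∂((Literature.MathematicalPhysics.KineticTheory.HeatConduction.pinnedChain ω₂ lam β γ).gibbsMeasure (N + 1) T))) + β * ∑ b : Fin N, ((if (b : ℕ) + 1 = x + (i : ℕ) then (1 : ℝ) else 0) - (if (b : ℕ) = x + (i : ℕ) then 1 else 0)) * ∫ t in Set.Ioi (0 : ℝ), (∫ z, z.2 0 * (∫ y, y.2 (⟨x + (i : ℕ), by omega⟩ : Fin (N + 1)) ∂((Literature.MathematicalPhysics.KineticTheory.HeatConduction.pinnedChain ω₂ lam β γ).transitionKernel (N + 1) T T t.toNNReal z))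 ∂((Literature.MathematicalPhysics.KineticTheory.HeatConduction.pinnedChain ω₂ lam β γ).gibbsMeasure (N + 1) T)) * (∫ z, z.2 0 * (∫ y, (y.1 (b).succ - y.1 (b).castSucc) ^ 3 ∂((Literature.MathematicalPhysics.KineticTheory.HeatConduction.pinnedChain ω₂ lam β γ).transitionKernel (N + 1) T T t.toNNReal z)) ∂((Literature.MathematicalPhysics.KineticTheory.HeatConduction.pinnedChain ω₂ lam β γ).gibbsMeasure (N + 1) T)))) ↔
    (∀ ω₂ lam β γ : ℝ, 0 < ω₂ → 0 < lam → 0 < β → 0 < γ → ∀ T : ℝ, 0 < T →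
      ∃ L₀ L K N₀ : ℕ, ∃ κ : ℝ, 0 < L₀ ∧ 0 < κ ∧ ∀ N : ℕ, N₀ ≤ N → ∀ (x : ℕ) (hx : x + L₀ + K ≤ N), L ≤ x →
        κ * ∑ i : Fin L₀, cohEnergy ω₂ lam β γ T N ⟨x + i, by omega⟩ ≤
          ∑ i : Fin L₀, siteWork ω₂ lam β γ T N ⟨x + i, by omega⟩) :=
  Iff.rfl

/-- Read-back: hypothesis 2 of `coherentDephasing_of_subs` (the child `ContactBound`, unfolded) is by `Iff.rfl` the contact
bound over the Defs vocabulary (`momResp`, `harmFlux`), in the upward-closed form `∃ K₀, ∀ K ≥ K₀` (the lead's v6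
`stub_contactBound` is its `∀ K` strengthening). [folklore] -/
theorem contactBound_iff :
    (∀ ω₂ lam β γ : ℝ, 0 < ω₂ → 0 < lam → 0 < β → 0 < γ → ∀ T : ℝ, 0 < T → ∃ K₀ : ℕ, ∀ K : ℕ, K₀ ≤ K → ∃ N₀ : ℕ, ∃ C : ℝ, 0 ≤ C ∧ ∀ (N : ℕ) (hN : K < N), N₀ ≤ N → γ * ∫ t in Set.Ioi (0 : ℝ), (∫ z, z.2 0 * (∫ y, y.2 (Fin.last N) ∂((Literature.MathematicalPhysics.KineticTheory.HeatConduction.pinnedChain ω₂ lam β γ).transitionKernel (N + 1) T T t.toNNReal z)) ∂((Literature.MathematicalPhysics.KineticTheory.HeatConduction.pinnedChain ω₂ lam β γ).gibbsMeasure (N + 1) T)) ^ 2 ≤ (1 + C) * max (-(1 / 2) * ∫ t in Set.Ioi (0 : ℝ), ((∫ z, z.2 0 * (∫ y, y.2 ((⟨N - K - 1, by omega⟩ : Fin N)).castSucc ∂((Literature.MathematicalPhysics.KineticTheory.HeatConduction.pinnedChain ω₂ lam β γ).transitionKernel (N + 1) T T t.toNNReal z)) ∂((Literature.MathematicalPhysics.KineticTheory.HeatConduction.pinnedChain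 ω₂ lam β γ).gibbsMeasure (N + 1) T)) + (∫ z, z.2 0 * (∫ y, y.2 ((⟨N - K - 1, by omega⟩ : Fin N)).succ ∂((Literature.MathematicalPhysics.KineticTheory.HeatConduction.pinnedChain ω₂ lam β γ).transitionKernel (N + 1) T T t.toNNReal z)) ∂((Literature.MathematicalPhysics.KineticTheory.HeatConduction.pinnedChain ω₂ lam β γ).gibbsMeasure (N + 1) T))) * ((∫ z, z.2 0 * (∫ y, y.1 ((⟨N - K - 1, by omega⟩ : Fin N)).succ ∂((Literature.MathematicalPhysics.KineticTheory.HeatConduction.pinnedChain ω₂ lam β γ).transitionKernel (N + 1) T T t.toNNReal z)) ∂((Literature.MathematicalPhysics.KineticTheory.HeatConduction.pinnedChain ω₂ lam β γ).gibbsMeasure (N + 1) T)) - (∫ z, z.2 0 * (∫ y, y.1 ((⟨N - K - 1, by omega⟩ : Fin N)).castSucc ∂((Literature.MathematicalPhysics.KineticTheory.HeatConduction.pinnedChain ω₂ lam β γ).transitionKernel (N + 1) T T t.toNNReal z)) ∂((Literature.MathematicalPhysics.KineticTheory.HeatConduction.pinnedChain ω₂ lam β γ).gibbsMeasure (N + 1)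 T)))) 0) ↔
    (∀ ω₂ lam β γ : ℝ, 0 < ω₂ → 0 < lam → 0 < β → 0 < γ → ∀ T : ℝ, 0 < T → ∃ K₀ : ℕ, ∀ K : ℕ, K₀ ≤ K →
      ∃ N₀ : ℕ, ∃ C : ℝ, 0 ≤ C ∧ ∀ (N : ℕ) (hN : K < N), N₀ ≤ N →
        γ * ∫ t in Set.Ioi (0 : ℝ), momResp ω₂ lam β γ T N (Fin.last N) t ^ 2 ≤
          (1 + C) * max (harmFlux ω₂ lam β γ T N ⟨N - K - 1, by omega⟩) 0) :=
  Iff.rfl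

/-- The lead's `∀ K` contact stub (v6 `stub_contactBound`, over the Defs vocabulary) implies the child `ContactBound`
(take `K₀ = 0`). [folklore] -/
theorem contactBound_of_forall_depth
    (h : ∀ ω₂ lam β γ : ℝ, 0 < ω₂ → 0 < lam → 0 < β → 0 < γ → ∀ T : ℝ, 0 < T → ∀ K : ℕ,
      ∃ N₀ : ℕ, ∃ C : ℝ, 0 ≤ C ∧ ∀ (N : ℕ) (hN : K < N), N₀ ≤ N →
        γ * ∫ t in Set.Ioi (0 : ℝ), momResp ω₂ lam β γ T N (Fin.last N) t ^ 2 ≤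
          (1 + C) * max (harmFlux ω₂ lam β γ T N ⟨N - K - 1, by omega⟩) 0) :
    (∀ ω₂ lam β γ : ℝ, 0 < ω₂ → 0 < lam → 0 < β → 0 < γ → ∀ T : ℝ, 0 < T → ∃ K₀ : ℕ, ∀ K : ℕ, K₀ ≤ K → ∃ N₀ : ℕ, ∃ C : ℝ, 0 ≤ C ∧ ∀ (N : ℕ) (hN : K < N), N₀ ≤ N → γ * ∫ t in Set.Ioi (0 : ℝ), (∫ z, z.2 0 * (∫ y, y.2 (Fin.last N) ∂((Literature.MathematicalPhysics.KineticTheory.HeatConduction.pinnedChain ω₂ lam β γ).transitionKernel (N + 1) T T t.toNNReal z)) ∂((Literature.MathematicalPhysics.KineticTheory.HeatConduction.pinnedChain ω₂ lam β γ).gibbsMeasure (N + 1) T)) ^ 2 ≤ (1 + C) * max (-(1 / 2) * ∫ t in Set.Ioi (0 : ℝ), ((∫ z, z.2 0 * (∫ y, y.2 ((⟨N - K - 1, by omega⟩ : Fin N)).castSucc ∂((Literature.MathematicalPhysics.KineticTheory.HeatConduction.pinnedChain ω₂ lam β γ).transitionKernel (N + 1) T T t.toNNReal z)) ∂((Literature.MathematicalPhysics.KineticTheory.HeatConduction.pinnedChain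 ω₂ lam β γ).gibbsMeasure (N + 1) T)) + (∫ z, z.2 0 * (∫ y, y.2 ((⟨N - K - 1, by omega⟩ : Fin N)).succ ∂((Literature.MathematicalPhysics.KineticTheory.HeatConduction.pinnedChain ω₂ lam β γ).transitionKernel (N + 1) T T t.toNNReal z)) ∂((Literature.MathematicalPhysics.KineticTheory.HeatConduction.pinnedChain ω₂ lam β γ).gibbsMeasure (N + 1) T))) * ((∫ z, z.2 0 * (∫ y, y.1 ((⟨N - K - 1, by omega⟩ : Fin N)).succ ∂((Literature.MathematicalPhysics.KineticTheory.HeatConduction.pinnedChain ω₂ lam β γ).transitionKernel (N + 1) T T t.toNNReal z)) ∂((Literature.MathematicalPhysics.KineticTheory.HeatConduction.pinnedChain ω₂ lam β γ).gibbsMeasure (N + 1) T)) - (∫ z, z.2 0 * (∫ y, y.1 ((⟨N - K - 1, by omega⟩ : Fin N)).castSucc ∂((Literature.MathematicalPhysics.KineticTheory.HeatConduction.pinnedChain ω₂ lam β γ).transitionKernel (N + 1) T T t.toNNReal z)) ∂((Literature.MathematicalPhysics.KineticTheory.HeatConduction.pinnedChain ω₂ lam β γ).gibbsMeasure (N + 1)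 T)))) 0) :=
  fun ω₂ lam β γ hω hl hβ hγ T hT => ⟨0, fun K _ => h ω₂ lam β γ hω hl hβ hγ T hT K⟩

end Summit.AtomisticToContinuum.FouriersLaw.Theorems.CoherentDephasing.Split

end
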